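import Mathlib
import Summits.Ventures.PercRepro2.Defs
import Summits.Ventures.PercRepro2.Harris
import Summits.Ventures.PercRepro2.CoinDefs
import Summits.Ventures.PercRepro2.CoinStarDefs
import Summits.Ventures.PercRepro2.CoinLsmCoreDefs
import Summits.Ventures.PercRepro2.CoinLsmCoreU
import Summits.Ventures.PercRepro2.CoinCoreGate
import Summits.Ventures.PercRepro2.CoinOrTailKDefs
import Summits.Ventures.PercRepro2.CoinOrTailKSums
import Summits.Ventures.PercRepro2.CoinOrTailKAlg
import Summits.Ventures.PercRepro2.CoinOrTailKCore
import Summits.Ventures.PercRepro2.CoinOrTailLsmCore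
import Summits.Ventures.PercRepro2.CoinTreeCore
import Summits.Ventures.PercRepro2.CoinKSureGen
import Summits.Ventures.PercRepro2.CoinKSureTailSums

/-!
# BOTH markers at the chain's OR-vertices — `(a', a)` (blind cell PercRepro2, night-2 g17;
proofs/NIGHT2-DARC.md §57.10)

The chain `a' → a` with `a'` entered from ANY `ent' ⊆ U` by ANY coins and `a` entered ONLY from
`a'` (any coin); the markers are the two OR-vertices themselves, `X = 1[a' ∈ S⁺]`,
`Y = 1[a ∈ S⁺]`.  Since `Y ≤ X` and the gate equals the `R`-law whenever `a` is not reached, the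
seven sums collapse to four atom sums `r₀` (nothing reached), `r₁` (`a'` reached, `a` not),
`r₁₂ / g₁₂` (both reached, `R` / gate) and the functional is the manifestly nonnegative
`r₀ · ((r₀ + r₁) · g₁₂ + r₁₂²)` (`markerAA_identity`): **`darc_of_chainMarkerAA'`**, the
`(a', a)` entry of the marker table for the AND-switch system, with no bound on `|ent'|` and no
sure coin; the mirror `(a, a')`.  No log-supermodularity is used at all — only the
level reductions (`sum_R_eq`/`sum_G_eq`, `sum_gen`, `sum_gen_tail` for the markers vanishing off
`a` and off `a'`).
-/

namespace Summit.Ventures.PercRepro2.Coin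

open Classical

section ChainMarkerAA

variable {V : Type*} {E : Type*} [Fintype V] [DecidableEq V] [Fintype E] [DecidableEq E]
  {R : Type*} [Field R] [LinearOrder R] [IsStrictOrderedRing R]
  {arcs : E → Finset (V × V)} {s : V} {U : Finset V} {ent ent' : Finset V} {c c' : V → E}
  {a a' w : V}

omit [Fintype V] [Fintype E] [DecidableEq E] [Field R] [LinearOrder R] [IsStrictOrderedRing R] in
/-- `starTarget a w` of a level containing `a` adds `w`. -/
lemma starTarget_of_mem (a w : V) {L : Finset V} (ha : a ∈ L) :
    starTarget a w L = insert w L := by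
  unfold starTarget; rw [if_pos ha]

omit [Fintype V] [Fintype E] [DecidableEq E] [Field R] [LinearOrder R] [IsStrictOrderedRing R] in
/-- `insert w (L ∪ {a}) = L ∪ {a, w}`. -/
lemma insert_union_singleton_eq (L : Finset V) (a w : V) :
    insert w (L ∪ {a}) = L ∪ {a, w} := by
  ext x; simp only [Finset.mem_insert, Finset.mem_union, Finset.mem_singleton]; tauto

omit [Fintype V] [DecidableEq V] [Fintype E] [DecidableEq E] [LinearOrder R] [IsStrictOrderedRing R] in
/-- The `(a', a)` functional in atom form. -/
lemma markerAA_identity (r₀ r₁ r₁₂ g₁₂ : R) :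
    (r₀ + r₁ + r₁₂) ^ 2 * g₁₂ - (r₀ + r₁ + r₁₂) * (r₁ + r₁₂) * g₁₂
      - (r₀ + r₁ + r₁₂) * r₁₂ * (r₁ + g₁₂) + (r₁ + r₁₂) * r₁₂ * (r₀ + r₁ + g₁₂) =
    r₀ * ((r₀ + r₁) * g₁₂ + r₁₂ ^ 2) := by ring

omit [Fintype V] in
/-- **THEOREM (row 2′DARC at a chained OR-vertex, BOTH markers at the OR-vertices `(a', a)`).**
`a'` an OR-vertex of `U` entered from ANY `ent' ⊆ U` by ANY coins, `a` an OR-vertex of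
`insert a' U` entered ONLY from `a'` (any coin), `SameEnds`, `t, w ∉ U ∪ {a, a', s}` ⟹
`DARC pr arcs s {t} a' a a w` — every core (no log-supermodularity needed), every head, every
probability vector, no bound on `|ent'|`, no sure coin anywhere. -/
theorem darc_of_chainMarkerAA' (pr : E → R) (hp : IsProbVec pr) (hS : SameEnds arcs)
    (h' : OrTailK arcs s U ent' c' a') (h : OrTailK arcs s (insert a' U) ent c a)
    (hcov : ∀ r ∈ ent, r = a')
    {t : V} (htC : t ∉ insert a (insert a' U)) (hts : t ≠ s) (hws : w ≠ s)
    (hwC : w ∉ insert a (insert a' U)) :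
    DARC pr arcs s {t} a' a a w := by
  have hC := h.closedInCoreU
  have ha'U : a' ∉ U := h'.a_notin
  have haU' : a ∉ insert a' U := h.a_notin
  have ha'a : a' ≠ a := fun e => haU' (e ▸ Finset.mem_insert_self a' U)
  have ha'C : a' ∈ insert a (insert a' U) := Finset.mem_insert_of_mem (Finset.mem_insert_self _ _)
  have haC : a ∈ insert a (insert a' U) := Finset.mem_insert_self _ _
  have hp0 := hp.nonneg
  have hp1 := hp.le_one
  unfold DARC
  rw [hC.phiC_gate_eq pr hS htC hts ha'C haC haC hws hwC]
  set A : Finset V → R := fun X => prob pr (coreAvoidEvent arcs s t (insert a (insert a' U)) X)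
    with hAdef
  have hA0 : ∀ X, 0 ≤ A X := fun X => prob_nonneg hp _
  -- marker invariances / vanishing
  have hm1 : ∀ W : Finset V, (fun _ : Finset V => (1 : R)) (insert a W) = (fun _ => (1 : R)) W :=
    fun _ => rfl
  have hm1' : ∀ W : Finset V, (fun _ : Finset V => (1 : R)) (insert a' W) = (fun _ => (1 : R)) W :=
    fun _ => rfl
  have hxa : ∀ W : Finset V, (fun W : Finset V => if a' ∈ W then (1 : R) else 0) (insert a W) =
      (fun W : Finset V => if a' ∈ W then (1 : R) else 0) W := by
    intro W; simp only [Finset.mem_insert, ha'a, false_or]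
  have hg0 : ∀ W : Finset V, a ∉ W → (fun W : Finset V => if a ∈ W then (1 : R) else 0) W = 0 := by
    intro W hW; simp only [hW, if_false]
  have hg1 : ∀ W : Finset V, a ∉ W →
      (fun W : Finset V => if a ∈ W then (1 : R) else 0) (insert a W) = (fun _ => (1 : R)) W := by
    intro W _; simp only [Finset.mem_insert_self, if_true]
  have hq0 : ∀ W : Finset V, a ∉ W →
      (fun W : Finset V => (if a' ∈ W then (1 : R) else 0) * (if a ∈ W then (1 : R) else 0)) W
        = 0 := by
    intro W hW; simp only [hW, if_false, mul_zero]
  have hq1 : ∀ W : Finset V, a ∉ W →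
      (fun W : Finset V => (if a' ∈ W then (1 : R) else 0) * (if a ∈ W then (1 : R) else 0))
          (insert a W) =
        (fun W : Finset V => if a' ∈ W then (1 : R) else 0) W := by
    intro W _
    simp only [Finset.mem_insert_self, if_true, mul_one, Finset.mem_insert, ha'a, false_or]
  have hg0' : ∀ W : Finset V, a' ∉ W →
      (fun W : Finset V => if a' ∈ W then (1 : R) else 0) W = 0 := by
    intro W hW; simp only [hW, if_false]
  have hg1' : ∀ W : Finset V, a' ∉ W →
      (fun W : Finset V => if a' ∈ W then (1 : R) else 0) (insert a' W) = (fun _ => (1 : R)) W := by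
    intro W _; simp only [Finset.mem_insert_self, if_true]
  -- the level reduction over `a` (core `insert a' U`): `sum_gen_tail` for the marker `1[a ∈ W]`
  have eΛ := h.sum_R_eq pr t (fun _ => (1 : R)) hm1
  have eFa := h.sum_R_eq pr t (fun W => if a' ∈ W then (1 : R) else 0) hxa
  have eFb := h.sum_gen_tail pr (fun X => prob pr (coreAvoidEvent arcs s t (insert a (insert a' U)) X))
    (fun W => if a ∈ W then (1 : R) else 0) (fun _ => (1 : R)) hg0 hg1
  have eM := h.sum_G_eq (w := w) pr t (fun _ => (1 : R)) hm1
  have eX := h.sum_G_eq (w := w) pr t (fun W => if a' ∈ W then (1 : R) else 0) hxa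
  have eY := h.sum_gen_tail pr
    (fun X => prob pr (coreAvoidEvent arcs s t (insert a (insert a' U)) (starTarget a w X)))
    (fun W => if a ∈ W then (1 : R) else 0) (fun _ => (1 : R)) hg0 hg1
  have eXY := h.sum_gen_tail pr
    (fun X => prob pr (coreAvoidEvent arcs s t (insert a (insert a' U)) (starTarget a w X)))
    (fun W => (if a' ∈ W then (1 : R) else 0) * (if a ∈ W then (1 : R) else 0))
    (fun W => if a' ∈ W then (1 : R) else 0) hq0 hq1
  simp only [mul_one] at eΛ eM eFb eY
  rw [eΛ, eFa, eFb, eM, eX, eY, eXY]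
  -- the inner values at level `a`
  set FR : Finset V → R := rValK A pr ent c a with hFR
  set FG : Finset V → R := gValK A pr ent c a w with hFG
  set FRe : Finset V → R := fun W => (1 - tailWtK pr ent c W) * A (W ∪ {a}) with hFRe
  set FGe : Finset V → R := fun W => (1 - tailWtK pr ent c W) * A (starTarget a w (W ∪ {a}))
    with hFGe
  -- the level reduction over `a'` (core `U`)
  have fΛ := h'.sum_gen pr FR (fun _ => (1 : R)) hm1'
  have fFa := h'.sum_gen_tail pr FR (fun W => if a' ∈ W then (1 : R) else 0) (fun _ => (1 : R))
    hg0' hg1'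
  have fFb := h'.sum_gen pr FRe (fun _ => (1 : R)) hm1'
  have fM := h'.sum_gen pr FG (fun _ => (1 : R)) hm1'
  have fX := h'.sum_gen_tail pr FG (fun W => if a' ∈ W then (1 : R) else 0) (fun _ => (1 : R))
    hg0' hg1'
  have fY := h'.sum_gen pr FGe (fun _ => (1 : R)) hm1'
  have fXY := h'.sum_gen_tail pr FGe (fun W => if a' ∈ W then (1 : R) else 0) (fun _ => (1 : R))
    hg0' hg1'
  simp only [mul_one] at fΛ fFa fFb fM fX fY fXY
  rw [fΛ, fFa, fFb, fM, fX, fY, fXY]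
  -- the atom sums
  set ν : Finset V → R := fun W => prob pr (coreLevel arcs s U W) with hνdef
  have hν0 : ∀ W, 0 ≤ ν W := fun W => prob_nonneg hp _
  set τ : Finset V → R := fun W => tailWtK pr ent' c' W with hτ
  set σ : Finset V → R := fun W => tailWtK pr ent c (W ∪ {a'}) with hσ
  have hτ0 : ∀ W, 0 ≤ τ W := fun W => tailWtK_nonneg hp1 ent' c' W
  have hτ1 : ∀ W, τ W ≤ 1 := fun W => tailWtK_le_one hp0 hp1 ent' c' W
  have hσ0 : ∀ W, 0 ≤ σ W := fun W => tailWtK_nonneg hp1 ent c _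
  have hσ1 : ∀ W, σ W ≤ 1 := fun W => tailWtK_le_one hp0 hp1 ent c _
  set r₀ := ∑ W ∈ U.powerset, ν W * (τ W * A W) with hr₀
  set r₁ := ∑ W ∈ U.powerset, ν W * ((1 - τ W) * (σ W * A (W ∪ {a'}))) with hr₁
  set r₁₂ := ∑ W ∈ U.powerset, ν W * ((1 - τ W) * ((1 - σ W) * A ((W ∪ {a'}) ∪ {a}))) with hr₁₂
  set g₁₂ := ∑ W ∈ U.powerset, ν W * ((1 - τ W) * ((1 - σ W) * A ((W ∪ {a'}) ∪ {a, w}))) with hg₁₂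
  have hr₀0 : 0 ≤ r₀ := Finset.sum_nonneg fun W _ => mul_nonneg (hν0 W) (mul_nonneg (hτ0 W) (hA0 W))
  have hr₁0 : 0 ≤ r₁ := Finset.sum_nonneg fun W _ =>
    mul_nonneg (hν0 W) (mul_nonneg (by linarith [hτ1 W]) (mul_nonneg (hσ0 W) (hA0 _)))
  have hr₁₂0 : 0 ≤ r₁₂ := Finset.sum_nonneg fun W _ =>
    mul_nonneg (hν0 W) (mul_nonneg (by linarith [hτ1 W]) (mul_nonneg (by linarith [hσ1 W]) (hA0 _)))
  have hg₁₂0 : 0 ≤ g₁₂ := Finset.sum_nonneg fun W _ =>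
    mul_nonneg (hν0 W) (mul_nonneg (by linarith [hτ1 W]) (mul_nonneg (by linarith [hσ1 W]) (hA0 _)))
  -- on a level of `U` the tail `a` has no entry (its only entry is `a'`)
  have hno : ∀ W ∈ U.powerset, tailWtK pr ent c W = 1 := by
    intro W hW
    apply tailWtK_eq_one_of_no_entry
    intro r hr hrW
    rw [hcov r hr] at hrW
    exact ha'U (Finset.mem_powerset.1 hW hrW)
  have hstar : ∀ W : Finset V, A (starTarget a w ((W ∪ {a'}) ∪ {a})) = A ((W ∪ {a'}) ∪ {a, w}) := by
    intro W
    rw [starTarget_of_mem a w (Finset.mem_union_right _ (Finset.mem_singleton_self a)),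
      insert_union_singleton_eq]
  -- the seven sums in atom form
  have cΛ : (∑ W ∈ U.powerset, ν W * (τ W * FR W + (1 - τ W) * FR (W ∪ {a'}))) =
      r₀ + r₁ + r₁₂ := by
    simp only [hr₀, hr₁, hr₁₂, ← Finset.sum_add_distrib]
    refine Finset.sum_congr rfl fun W hW => ?_
    simp only [hFR, rValK, hno W hW]
    ring
  have cFa : (∑ W ∈ U.powerset, ν W * ((1 - τ W) * FR (W ∪ {a'}))) = r₁ + r₁₂ := by
    simp only [hr₁, hr₁₂, ← Finset.sum_add_distrib]
    refine Finset.sum_congr rfl fun W _ => ?_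
    simp only [hFR, rValK]
    ring
  have cFb : (∑ W ∈ U.powerset, ν W * (τ W * FRe W + (1 - τ W) * FRe (W ∪ {a'}))) = r₁₂ := by
    simp only [hr₁₂]
    refine Finset.sum_congr rfl fun W hW => ?_
    simp only [hFRe, hno W hW]
    ring
  have cM : (∑ W ∈ U.powerset, ν W * (τ W * FG W + (1 - τ W) * FG (W ∪ {a'}))) =
      r₀ + r₁ + g₁₂ := by
    simp only [hr₀, hr₁, hg₁₂, ← Finset.sum_add_distrib]
    refine Finset.sum_congr rfl fun W hW => ?_
    simp only [hFG, gValK, hno W hW]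
    ring
  have cX : (∑ W ∈ U.powerset, ν W * ((1 - τ W) * FG (W ∪ {a'}))) = r₁ + g₁₂ := by
    simp only [hr₁, hg₁₂, ← Finset.sum_add_distrib]
    refine Finset.sum_congr rfl fun W _ => ?_
    simp only [hFG, gValK]
    ring
  have cY : (∑ W ∈ U.powerset, ν W * (τ W * FGe W + (1 - τ W) * FGe (W ∪ {a'}))) = g₁₂ := by
    simp only [hg₁₂]
    refine Finset.sum_congr rfl fun W hW => ?_
    simp only [hFGe, hno W hW, hstar W]
    ring
  have cXY : (∑ W ∈ U.powerset, ν W * ((1 - τ W) * FGe (W ∪ {a'}))) = g₁₂ := by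
    simp only [hg₁₂]
    refine Finset.sum_congr rfl fun W _ => ?_
    simp only [hFGe, hstar W, hσ]
  rw [cΛ, cFa, cFb, cM, cX, cY, cXY, markerAA_identity]
  exact mul_nonneg hr₀0 (add_nonneg (mul_nonneg (add_nonneg hr₀0 hr₁0) hg₁₂0) (sq_nonneg _))

omit [Fintype V] in
/-- **The mirror: markers `(a, a')`.** -/
theorem darc_of_chainMarkerAA'_swap (pr : E → R) (hp : IsProbVec pr) (hS : SameEnds arcs)
    (h' : OrTailK arcs s U ent' c' a') (h : OrTailK arcs s (insert a' U) ent c a)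
    (hcov : ∀ r ∈ ent, r = a')
    {t : V} (htC : t ∉ insert a (insert a' U)) (hts : t ≠ s) (hws : w ≠ s)
    (hwC : w ∉ insert a (insert a' U)) :
    DARC pr arcs s {t} a a' a w :=
  (darc_swap pr arcs s {t} a' a a w).1
    (darc_of_chainMarkerAA' pr hp hS h' h hcov htC hts hws hwC)

end ChainMarkerAA

end Summit.Ventures.PercRepro2.Coin
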